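import Literature.Analysis.FluidPDE.SpaceTimeMollifier
import HarnessLib

/-!
# The mollified pressure Poisson equation of a distributional Navier–Stokes solution

Analysis/FluidPDE support file on the decomposition path of the named fact
`Literature.Analysis.FluidPDE.SereginSverak2009.PressureDecay` (G. Seregin, V. Šverák, Comm. PDE
34 (2009) = arXiv:0804.1803, proof of Lemma 3.5, (as13): the decay estimate
`D(z_b, ϱ; q) ≤ c[(ϱ/r) D(z_b, r; q) + (r/ϱ)² C(z_b, r; v)]` for the pressure). Every proof of
(as13) starts from the **pressure equation** `Δq = -div div (v ⊗ v) = -∂ᵢ∂ⱼ(vᵢvⱼ)`, obtained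
from the Navier–Stokes system by taking the divergence (Seregin, *Lecture notes on regularity
theory for the Navier–Stokes equations* (2014), p. 111: "the pressure equation:
`Δq = -vᵢ,ⱼvⱼ,ᵢ`"; decomposition `q = q₁ + q₂`, ibid. and (6.1.23)–(6.1.24), p. 92). For a
distributional solution `(u, p)` on an open `Q ⊆ ℝ × E` (accepted
`Fluid.IsDistributionalNSSolutionOn Q ν 0 u p`: the momentum equation is tested against **all**
smooth compactly supported fields, so the choice `ψ = ∇θ` is available) the equation holds in
`𝒟'(Q)`; this file proves it in the **mollified, pointwise** form in which it is consumed
(Caffarelli–Kohn–Nirenberg 1982, §2: "the equations hold for the mollified functions"): for a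
`C^∞` kernel `k` on `ℝ × E` vanishing outside `closedBall 0 r` and every centre with
`closedBall (t₀, x₀) r ⊆ Q`,

  `Δₓ (k ⋆ 𝟙_Q p)(t₀, ·)(x₀) = -Σᵢⱼ ∂ᵢ∂ⱼ (k ⋆ 𝟙_Q (uᵢuⱼ))(t₀, ·)(x₀)`

(`IsDistributionalNSSolutionOn.laplacian_mollified_pressure`, `uᵢ = ⟪u, bᵢ⟫` in any orthonormal
basis `b` of `E`; `k ⋆ 𝟙_Q ·` is the space–time mollification `Fluid.stMollify k (zeroExt Q ·)`
of the tree, `FluidPDE/SpaceTimeMollifier`).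

## Proof

The tree proves the mollified momentum equation
(`IsDistributionalNSSolutionOn.mollified_momentum`): for every admissible kernel `k'` and vector
`e`, `⟪∂ₜ(k' ⋆ 𝟙u), e⟫ + div (k' ⋆ 𝟙(⟪u,e⟫u)) - ν⟪Δ(k' ⋆ 𝟙u), e⟫ + ∂ₑ(k' ⋆ 𝟙p) = 0` at
`(t₀, x₀)`, and that `div (k' ⋆ 𝟙u) = 0` there (`divergence_mollified_eq_zero`). We apply the
first with the *differentiated kernels* `k' = ∂_{(0,bᵢ)} k` and `e = bᵢ` and sum over `i`:
since derivatives of a mollification are mollifications by the differentiated kernel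
(`fderiv_stMollify_apply`, `timeDeriv_stMollify`, `laplacian_stMollify`) and mixed derivatives
of the smooth kernel commute (Schwarz), the four sums are `div (∂ₜk ⋆ 𝟙u) = 0`,
`Σᵢⱼ ∂ⱼ∂ᵢ(k ⋆ 𝟙(uᵢuⱼ))`, `ν div (Δ_y k ⋆ 𝟙u) = 0` and `Σᵢ ∂ᵢ∂ᵢ(k ⋆ 𝟙p) = Δ(k ⋆ 𝟙p)` — i.e. we
take the divergence of the mollified momentum equation, exactly as in print.

## References

* L. Caffarelli, R. Kohn, L. Nirenberg, *Partial regularity of suitable weak solutions of the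
  Navier–Stokes equations*, CPAM 35 (1982), §2 (mollified equations; (2.3) `-Δp = ∂ᵢ∂ⱼ(uᵢuⱼ)`).
  [`CaffarelliKohnNirenberg1982`]
* G. Seregin, *Lecture notes on regularity theory for the Navier–Stokes equations*, World
  Scientific (2014), (6.1.23)–(6.1.25) p. 92 and §6.3 p. 111 (the pressure equation).
  [`Seregin2014`]
* G. Seregin, V. Šverák, Comm. PDE 34 (2009) = arXiv:0804.1803, proof of Lemma 3.5, (as13).
  [`SereginSverak2009`]
-/

noncomputable section

open MeasureTheory TopologicalSpace Set Function Filter Topology ContinuousLinearMap Metric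
  InnerProductSpace
open scoped ENNReal NNReal Convolution Laplacian RealInnerProductSpace ContDiff

namespace Literature.Analysis.FluidPDE

/-! ### Schwarz's theorem on a real normed space, directional form -/

section Schwarz

variable {G : Type*} [NormedAddCommGroup G] [NormedSpace ℝ G]
variable {F : Type*} [NormedAddCommGroup F] [NormedSpace ℝ F]

/-- Evaluating an operator-valued map at a fixed vector commutes with `fderiv`:
`D(y ↦ H(y) c)(x) a = DH(x) a c` (general normed spaces). [folklore] -/
theorem fderiv_clm_apply_const_apply {H : G → G →L[ℝ] F} {x : G} (hH : DifferentiableAt ℝ H x)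
    (c a : G) : fderiv ℝ (fun y => H y c) x a = fderiv ℝ H x a c := by
  rw [fderiv_clm_apply hH (differentiableAt_const c)]
  simp

/-- **Schwarz**: mixed second directional derivatives of a `C²` real function on a real normed
space commute, `∂ᵤ∂ᵥf = ∂ᵥ∂ᵤf` (Mathlib `ContDiffAt.isSymmSndFDerivAt`). [folklore] -/
theorem fderiv_fderiv_apply_comm_of_contDiff {f : G → ℝ} (hf : ContDiff ℝ 2 f) (x u v : G) :
    fderiv ℝ (fun y => fderiv ℝ f y v) x u = fderiv ℝ (fun y => fderiv ℝ f y u) x v := by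
  have hd : DifferentiableAt ℝ (fderiv ℝ f) x :=
    ((hf.fderiv_right (m := 1) le_rfl).differentiable one_ne_zero) x
  have h22 : minSmoothness ℝ 2 ≤ (2 : ℕ∞ω) := by
    rw [minSmoothness_of_isRCLikeNormedField]
  rw [fderiv_clm_apply_const_apply hd, fderiv_clm_apply_const_apply hd]
  exact (hf.contDiffAt.isSymmSndFDerivAt h22).eq u v

/-- Schwarz for the differentiated kernels of a `C^∞` function, as an identity of functions:
`∂ᵤ(∂ᵥf) = ∂ᵥ(∂ᵤf)`. [folklore] -/
theorem fderiv_fderiv_apply_comm_fun {f : G → ℝ} (hf : ContDiff ℝ ∞ f) (u v : G) :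
    (fun x => fderiv ℝ (fun y => fderiv ℝ f y v) x u) =
      fun x => fderiv ℝ (fun y => fderiv ℝ f y u) x v :=
  funext fun x => fderiv_fderiv_apply_comm_of_contDiff (hf.of_le two_le_infty) x u v

end Schwarz

/-! ### The spatial Laplacian commutes with space–time directional derivatives -/

section SpaceLaplacian

variable {E : Type*} [NormedAddCommGroup E] [InnerProductSpace ℝ E] [FiniteDimensional ℝ E]

/-- **`∂_V Δ_y k = Δ_y ∂_V k`** for a `C^∞` space–time kernel `k : ℝ × E → ℝ` and any
space–time direction `V` (Schwarz twice). [folklore] -/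
theorem fderiv_spaceLaplacian_apply {k : ℝ × E → ℝ} (hk : ContDiff ℝ ∞ k) (w V : ℝ × E) :
    fderiv ℝ (spaceLaplacian k) w V = spaceLaplacian (fun w' => fderiv ℝ k w' V) w := by
  set b := stdOrthonormalBasis ℝ E
  have hkV : ContDiff ℝ ∞ fun w' => fderiv ℝ k w' V := contDiff_fderiv_apply_const hk V
  have hkj : ∀ j, ContDiff ℝ ∞ fun w' => fderiv ℝ k w' (0, b j) := fun j =>
    contDiff_fderiv_apply_const hk _
  have hkjj : ∀ j, ContDiff ℝ ∞ fun w => fderiv ℝ (fun w' => fderiv ℝ k w' (0, b j)) w (0, b j) :=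
    fun j => contDiff_fderiv_apply_const (hkj j) _
  rw [spaceLaplacian_eq_sum_fun hk, spaceLaplacian_eq_sum_fun hkV,
    fderiv_fun_sum fun j _ => ((hkjj j).differentiable (by simp) w), _root_.sum_apply]
  refine Finset.sum_congr rfl fun j _ => ?_
  -- `∂_V ∂ⱼ ∂ⱼ k = ∂ⱼ ∂_V ∂ⱼ k = ∂ⱼ ∂ⱼ ∂_V k`
  rw [fderiv_fderiv_apply_comm_of_contDiff ((hkj j).of_le two_le_infty) w V (0, b j),
    fderiv_fderiv_apply_comm_fun hk V (0, b j)]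

end SpaceLaplacian

/-! ### The mollified pressure equation -/

section Pressure

variable {E : Type*} [NormedAddCommGroup E] [InnerProductSpace ℝ E] [FiniteDimensional ℝ E]
  [MeasurableSpace E] [BorelSpace E]

-- Lebesgue measure on space–time `ℝ × E` is an additive Haar measure: the tree's instance
-- (`FluidPDE/SpaceTimeMollifier`), activated locally (instance search does not find the product
-- Haar instance through `volume`).
attribute [local instance] instIsAddHaarMeasureVolumeSpaceTime

variable {Q : Opens (ℝ × E)} {ν : ℝ} {u : ℝ → E → E} {p : ℝ → E → ℝ}
variable {k : ℝ × E → ℝ} {r t₀ : ℝ} {x₀ : E}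

/-- The products `uᵢuⱼ = ⟪u, a⟫⟪u, c⟫` of the components of a field with `|u|² ∈ L¹(Q)` are
integrable on `Q`. [folklore] -/
theorem integrableOn_inner_mul_inner (hu : IntegrableOn (uncurry u) (Q : Set (ℝ × E)) volume)
    (hu2 : IntegrableOn (fun z => ‖uncurry u z‖ ^ 2) (Q : Set (ℝ × E)) volume) (a c : E) :
    IntegrableOn (uncurry fun t x => ⟪u t x, a⟫ * ⟪u t x, c⟫) (Q : Set (ℝ × E)) volume := by
  refine Integrable.mono' (hu2.mul_const (‖a‖ * ‖c‖)) ?_ (Eventually.of_forall fun z => ?_)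
  · exact (hu.aestronglyMeasurable.inner aestronglyMeasurable_const).mul
      (hu.aestronglyMeasurable.inner aestronglyMeasurable_const)
  · change ‖⟪u z.1 z.2, a⟫ * ⟪u z.1 z.2, c⟫‖ ≤ ‖uncurry u z‖ ^ 2 * (‖a‖ * ‖c‖)
    rw [norm_mul]
    calc ‖⟪u z.1 z.2, a⟫‖ * ‖⟪u z.1 z.2, c⟫‖
        ≤ (‖u z.1 z.2‖ * ‖a‖) * (‖u z.1 z.2‖ * ‖c‖) :=
          mul_le_mul (norm_inner_le_norm _ _) (norm_inner_le_norm _ _) (norm_nonneg _)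
            (by positivity)
      _ = ‖uncurry u z‖ ^ 2 * (‖a‖ * ‖c‖) := by
          rw [show uncurry u z = u z.1 z.2 from rfl]; ring

/-- The transport fields `⟪u, e⟫ u` of a field with `|u|² ∈ L¹(Q)` are integrable on `Q` (as in
the proof of `mollified_momentum`; private copy of the tree's lemma of the same name in
`FluidPDE/NSBoundedSuitableCauchy`, not imported to keep this file light). [folklore] -/
private theorem integrableOn_inner_smul_transport (hu : IntegrableOn (uncurry u) (Q : Set (ℝ × E)) volume)
    (hu2 : IntegrableOn (fun z => ‖uncurry u z‖ ^ 2) (Q : Set (ℝ × E)) volume) (e : E) :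
    IntegrableOn (uncurry fun t x => ⟪u t x, e⟫ • u t x) (Q : Set (ℝ × E)) volume := by
  refine Integrable.mono' (hu2.mul_const ‖e‖) ?_ (Eventually.of_forall fun z => ?_)
  · exact (hu.aestronglyMeasurable.inner aestronglyMeasurable_const).smul hu.aestronglyMeasurable
  · change ‖⟪u z.1 z.2, e⟫ • u z.1 z.2‖ ≤ ‖uncurry u z‖ ^ 2 * ‖e‖
    rw [norm_smul]
    calc ‖⟪u z.1 z.2, e⟫‖ * ‖u z.1 z.2‖ ≤ (‖u z.1 z.2‖ * ‖e‖) * ‖u z.1 z.2‖ := by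
          gcongr; exact norm_inner_le_norm _ _
      _ = ‖uncurry u z‖ ^ 2 * ‖e‖ := by rw [show uncurry u z = u z.1 z.2 from rfl]; ring

/-- **The mollified pressure Poisson equation.** Let `(u, p)` be a distributional solution of
the unforced Navier–Stokes system on an open set `Q ⊆ ℝ × E` (accepted
`Fluid.IsDistributionalNSSolutionOn`) with `u`, `|u|²`, `p` integrable on `Q`; let `k` be a
`C^∞` kernel on `ℝ × E` vanishing outside `closedBall 0 r`, and let `closedBall (t₀, x₀) r ⊆ Q`.
Then the space–time mollifications `P = k ⋆ 𝟙_Q p` and `Tᵢⱼ = k ⋆ 𝟙_Q (uᵢuⱼ)`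
(`uᵢ = ⟪u, bᵢ⟫`, `b` any orthonormal basis of `E`) satisfy the pressure equation **pointwise**
at `(t₀, x₀)`: `Δ P(t₀, ·)(x₀) = -Σᵢ Σⱼ ∂ⱼ∂ᵢ Tᵢⱼ(t₀, ·)(x₀)` — the divergence of the mollified
momentum equation (`mollified_momentum` with the kernels `∂_{(0,bᵢ)}k`, summed over `i`; the
`∂ₜ` and `νΔ` terms are divergences of mollified velocities and vanish by
`divergence_mollified_eq_zero`). This is `Δq = -div div (v ⊗ v)` (Seregin 2014, p. 111;
Caffarelli–Kohn–Nirenberg 1982, (2.3)) "for the mollified functions" (CKN 1982, §2).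
[cite: CaffarelliKohnNirenberg1982, §2] -/
theorem IsDistributionalNSSolutionOn.laplacian_mollified_pressure
    (h : IsDistributionalNSSolutionOn Q ν 0 u p)
    (hu : IntegrableOn (uncurry u) (Q : Set (ℝ × E)) volume)
    (hu2 : IntegrableOn (fun z => ‖uncurry u z‖ ^ 2) (Q : Set (ℝ × E)) volume)
    (hp : IntegrableOn (uncurry p) (Q : Set (ℝ × E)) volume)
    (hk : ContDiff ℝ ∞ k) (hkr : ∀ w, w ∉ closedBall (0 : ℝ × E) r → k w = 0)
    (hQ : closedBall ((t₀, x₀) : ℝ × E) r ⊆ Q) {ι : Type*} [Fintype ι]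
    (b : OrthonormalBasis ι ℝ E) :
    (Δ (stMollify k (zeroExt Q p) t₀)) x₀ =
      -∑ i, ∑ j, fderiv ℝ (fun y => fderiv ℝ
        (stMollify k (zeroExt Q fun t x => ⟪u t x, b i⟫ * ⟪u t x, b j⟫) t₀) y (b i)) x₀ (b j) := by
  -- the kernel and its derivatives
  have hkc : HasCompactSupport k := hasCompactSupport_of_closedBall hkr
  set kx : E → ℝ × E → ℝ := fun v w => fderiv ℝ k w (0, v) with hkx_def
  have hkx : ∀ v, ContDiff ℝ ∞ (kx v) := fun v => contDiff_fderiv_apply_const hk _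
  have hkxr : ∀ v, ∀ w, w ∉ closedBall (0 : ℝ × E) r → kx v w = 0 := fun v =>
    fderiv_apply_eq_zero_of_closedBall hkr _
  have hkxc : ∀ v, HasCompactSupport (kx v) := fun v => hasCompactSupport_of_closedBall (hkxr v)
  set kt : ℝ × E → ℝ := fun w => fderiv ℝ k w (1, 0) with hkt_def
  have hkt : ContDiff ℝ ∞ kt := contDiff_fderiv_apply_const hk _
  have hktr : ∀ w, w ∉ closedBall (0 : ℝ × E) r → kt w = 0 :=
    fderiv_apply_eq_zero_of_closedBall hkr _
  have hktc : HasCompactSupport kt := hasCompactSupport_of_closedBall hktr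
  have hkΔ : ContDiff ℝ ∞ (spaceLaplacian k) := contDiff_spaceLaplacian hk
  have hkΔr : ∀ w, w ∉ closedBall (0 : ℝ × E) r → spaceLaplacian k w = 0 :=
    spaceLaplacian_eq_zero_of_closedBall hk hkr
  have hkΔc : HasCompactSupport (spaceLaplacian k) := hasCompactSupport_of_closedBall hkΔr
  -- the zero extensions
  have hU : LocallyIntegrable (zeroExt Q u) volume := locallyIntegrable_zeroExt hu
  have hP : LocallyIntegrable (zeroExt Q p) volume := locallyIntegrable_zeroExt hp
  have hN : ∀ i, LocallyIntegrable (zeroExt Q fun t x => ⟪u t x, b i⟫ • u t x) volume := fun i =>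
    locallyIntegrable_zeroExt (integrableOn_inner_smul_transport hu hu2 (b i))
  have hT : ∀ i j, LocallyIntegrable (zeroExt Q fun t x => ⟪u t x, b i⟫ * ⟪u t x, b j⟫) volume :=
    fun i j => locallyIntegrable_zeroExt (integrableOn_inner_mul_inner hu hu2 (b i) (b j))
  -- the mollified momentum equation with the kernels `∂_{(0,bᵢ)} k`
  have hmom := fun i => h.mollified_momentum hu hu2 hp (hkx (b i)) (hkxr (b i)) hQ (b i)
  -- (1) the pressure terms sum to `Δ P`
  have h4 : ∀ i, fderiv ℝ (stMollify (kx (b i)) (zeroExt Q p) t₀) x₀ (b i) =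
      fderiv ℝ (fun y => fderiv ℝ (stMollify k (zeroExt Q p) t₀) y (b i)) x₀ (b i) := by
    intro i
    have hfun : stMollify (kx (b i)) (zeroExt Q p) t₀ =
        fun y => fderiv ℝ (stMollify k (zeroExt Q p) t₀) y (b i) :=
      funext fun y => (fderiv_stMollify_apply hk hkc hP t₀ y (b i)).symm
    rw [hfun]
  have hP2 : ContDiff ℝ 2 (stMollify k (zeroExt Q p) t₀) :=
    (contDiff_stMollify_slice hk hkc hP t₀).of_le two_le_infty
  have s4 : ∑ i, fderiv ℝ (stMollify (kx (b i)) (zeroExt Q p) t₀) x₀ (b i) =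
      (Δ (stMollify k (zeroExt Q p) t₀)) x₀ := by
    rw [laplacian_eq_sum_fderiv_fderiv b hP2 x₀]
    exact Finset.sum_congr rfl fun i _ => h4 i
  -- (2) the time-derivative terms sum to `div (∂ₜk ⋆ 𝟙u) = 0`
  have h1 : ∀ i, ⟪timeDeriv (stMollify (kx (b i)) (zeroExt Q u)) t₀ x₀, b i⟫ =
      ⟪fderiv ℝ (stMollify kt (zeroExt Q u) t₀) x₀ (b i), b i⟫ := by
    intro i
    rw [timeDeriv_stMollify (hkx (b i)) (hkxc (b i)) hU t₀ x₀,
      fderiv_stMollify_apply hkt hktc hU t₀ x₀ (b i)]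
    change ⟪stMollify (fun w => fderiv ℝ (fun y => fderiv ℝ k y (0, b i)) w (1, 0))
      (zeroExt Q u) t₀ x₀, b i⟫ = ⟪stMollify (fun w => fderiv ℝ (fun y => fderiv ℝ k y (1, 0))
        w (0, b i)) (zeroExt Q u) t₀ x₀, b i⟫
    rw [fderiv_fderiv_apply_comm_fun hk (1, 0) (0, b i)]
  have s1 : ∑ i, ⟪timeDeriv (stMollify (kx (b i)) (zeroExt Q u)) t₀ x₀, b i⟫ = 0 := by
    rw [Finset.sum_congr rfl fun i _ => h1 i]
    have hdiv := h.divergence_mollified_eq_zero hu hkt hktr hQ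
    rw [divergence_eq_sum_inner_fderiv b] at hdiv
    simpa only [real_inner_comm] using hdiv
  -- (3) the viscous terms sum to `div (Δ_y k ⋆ 𝟙u) = 0`
  have h3 : ∀ i, ⟪(Δ (stMollify (kx (b i)) (zeroExt Q u) t₀)) x₀, b i⟫ =
      ⟪fderiv ℝ (stMollify (spaceLaplacian k) (zeroExt Q u) t₀) x₀ (b i), b i⟫ := by
    intro i
    rw [laplacian_stMollify (hkx (b i)) (hkxc (b i)) hU t₀ x₀,
      fderiv_stMollify_apply hkΔ hkΔc hU t₀ x₀ (b i)]
    have hker : spaceLaplacian (kx (b i)) = fun w => fderiv ℝ (spaceLaplacian k) w (0, b i) :=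
      funext fun w => (fderiv_spaceLaplacian_apply hk w (0, b i)).symm
    rw [hker]
  have s3 : ∑ i, ⟪(Δ (stMollify (kx (b i)) (zeroExt Q u) t₀)) x₀, b i⟫ = 0 := by
    rw [Finset.sum_congr rfl fun i _ => h3 i]
    have hdiv := h.divergence_mollified_eq_zero hu hkΔ hkΔr hQ
    rw [divergence_eq_sum_inner_fderiv b] at hdiv
    simpa only [real_inner_comm] using hdiv
  -- (4) the transport terms are `Σⱼ ∂ⱼ∂ᵢ Tᵢⱼ`
  have h2 : ∀ i, VectorCalculus.divergence
      (stMollify (kx (b i)) (zeroExt Q fun t x => ⟪u t x, b i⟫ • u t x) t₀) x₀ =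
      ∑ j, fderiv ℝ (fun y => fderiv ℝ
        (stMollify k (zeroExt Q fun t x => ⟪u t x, b i⟫ * ⟪u t x, b j⟫) t₀) y (b i)) x₀ (b j) := by
    intro i
    rw [divergence_eq_sum_inner_fderiv b]
    refine Finset.sum_congr rfl fun j _ => ?_
    -- left: `⟪bⱼ, ∂ⱼ(∂ᵢk ⋆ 𝟙(uᵢu))⟫ = (∂ⱼ∂ᵢk ⋆ 𝟙(uᵢuⱼ))`
    have hexN : ConvolutionExistsAt (fun w => fderiv ℝ (kx (b i)) w (0, b j))
        (zeroExt Q fun t x => ⟪u t x, b i⟫ • u t x) (t₀, x₀) (lsmul ℝ ℝ) volume :=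
      (hasCompactSupport_fderiv_apply_const (hkxc (b i)) _).convolutionExists_left _
        (contDiff_fderiv_apply_const (hkx (b i)) _).continuous (hN i) _
    have hcomp : (fun w => ⟪zeroExt Q (fun t x => ⟪u t x, b i⟫ • u t x) w, b j⟫) =
        zeroExt Q fun t x => ⟪u t x, b i⟫ * ⟪u t x, b j⟫ := by
      funext w
      rw [inner_zeroExt_left]
      congr 1
      funext t x
      exact real_inner_smul_left _ _ _
    rw [real_inner_comm, fderiv_stMollify_apply (hkx (b i)) (hkxc (b i)) (hN i) t₀ x₀ (b j),
      stMollify_apply, inner_convolution_lsmul_apply hexN (b j), hcomp]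
    -- right: `∂ⱼ (y ↦ ∂ᵢ(k ⋆ 𝟙(uᵢuⱼ))(y)) = ∂ⱼ (∂ᵢk ⋆ 𝟙(uᵢuⱼ)) = (∂ⱼ∂ᵢk ⋆ 𝟙(uᵢuⱼ))`
    have hfun : (fun y => fderiv ℝ
        (stMollify k (zeroExt Q fun t x => ⟪u t x, b i⟫ * ⟪u t x, b j⟫) t₀) y (b i)) =
        stMollify (kx (b i)) (zeroExt Q fun t x => ⟪u t x, b i⟫ * ⟪u t x, b j⟫) t₀ :=
      funext fun y => fderiv_stMollify_apply hk hkc (hT i j) t₀ y (b i)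
    rw [hfun, fderiv_stMollify_apply (hkx (b i)) (hkxc (b i)) (hT i j) t₀ x₀ (b j)]
    rfl
  -- sum the momentum equations over `i`
  have hsum : ∑ i, (⟪timeDeriv (stMollify (kx (b i)) (zeroExt Q u)) t₀ x₀, b i⟫ +
      VectorCalculus.divergence
        (stMollify (kx (b i)) (zeroExt Q fun t x => ⟪u t x, b i⟫ • u t x) t₀) x₀ -
      ν * ⟪(Δ (stMollify (kx (b i)) (zeroExt Q u) t₀)) x₀, b i⟫ +
      fderiv ℝ (stMollify (kx (b i)) (zeroExt Q p) t₀) x₀ (b i)) = 0 :=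
    Finset.sum_eq_zero fun i _ => hmom i
  simp only [Finset.sum_add_distrib, Finset.sum_sub_distrib, ← Finset.mul_sum, s1, s3, s4,
    mul_zero, sub_zero, zero_add] at hsum
  rw [Finset.sum_congr rfl fun i _ => h2 i] at hsum
  linarith

end Pressure

end Literature.Analysis.FluidPDE

end
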